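import Mathlib
import Summits.NavierStokesRegularity.NavierStokesRegularity.Theorems.FilamentSkeletonRssStadiumDeviationRatio
import Summits.NavierStokesRegularity.NavierStokesRegularity.Theorems.FilamentSkeletonRssStadiumPairPositivity

/-!
# Vertical displacement MINUS its linear part, and the sharp own-filament far kernel (`TangentSkeletonNearStraightL`,
# stmt-NavierStokesRegularity-23320, registered stub `stub_stripPropagation`)

For the unshifted real sources of the OWN filament the crude decomposition `F(z) − X(σ) = (X(x) − X(σ)) + e`, `‖e‖ ≤ 2|y|`
(Theorems.StadiumVerticalDisplacement, Theorems.StadiumOwnFarKernel: needs chord `d ≥ 12|y|`) wastes the structure of the vertical displacement: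
`F(x+iy) − F(x) = iy·X′(x) + b`, with `b = i∫₀ʸ (F′(x+it) − F′(x)) dt` SMALL by the Cauchy–log deviation (Theorems.StadiumTangentDeviation /
StadiumDeviationRatio): `‖b‖ ≤ |y|·M·log(n/(n−1))` when the `n`-fold discs fit (`vertical_sub_linear_norm_le`).  Since `iy·X′(x)` is purely
imaginary along a REAL unit vector, `Re Σᵢ (uᵢ + iyTᵢ + bᵢ)² ≥ ‖u‖² − y² − 3β² − 2√3·β(‖u‖ + |y|)` (`re_sum_sq_vertical_linear_ge`, `β` the sup bound
of `b`): positive as soon as `‖u‖ ≳ 1.5|y|` for `n = 8` (`β ≤ 0.27|y|`) — so the own-filament real sources beyond a connector at horizontal distance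
`7h` from the `cs√Γ/16`-stadium (chord `≥ 6.1 h ≥ 6.1|y|`) are on the principal branch with `Re ≥ 0.79 d²`.  This is what lets the retyped
contour be ONE plateau `|Re ζ − c_j| ≤ L + 8h` at height `Im z` with TWO fixed vertical connectors (no staircase; one rectangle for contour
independence, Theorems.StadiumShiftedContour) — addendum to evidence `DIAG-stripPropagation-ends-g2.md` on 23320.
HONEST FRAMING: a tool for a HYPOTHETICAL filament skeleton on the NEGATIVE side of a MODEL route; nothing here bears on Navier–Stokes regularity
or blow-up.  `--supports stmt-NavierStokesRegularity-23320`.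
-/

set_option linter.dupNamespace false

noncomputable section

namespace Summit.NavierStokesRegularity.NavierStokesRegularity.Theorems.StadiumVerticalLinear

open Set Metric MeasureTheory intervalIntegral
open scoped InnerProductSpace
open Summit.NavierStokesRegularity.NavierStokesRegularity.Theorems.StadiumTangentDeviation
open Summit.NavierStokesRegularity.NavierStokesRegularity.Theorems.StadiumDeviationPackage
open Summit.NavierStokesRegularity.NavierStokesRegularity.Theorems.StadiumDeviationRatio
open Summit.NavierStokesRegularity.NavierStokesRegularity.Theorems.StadiumPairPositivity

/-- **Vertical displacement minus its linear part.**  `F` holomorphic on an open `U` containing the vertical segment from `x` to `x + iy`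
(`0 ≤ y`), with `‖F′(x+it) − F′(x)‖ ≤ β₁` along it: then `‖F(x+iy) − F(x) − (iy)•F′(x)‖ ≤ β₁·y`. [folklore] -/
theorem vertical_sub_linear_norm_le {U : Set ℂ} (hU : IsOpen U) {F : ℂ → (Fin 3 → ℂ)} (hF : DifferentiableOn ℂ F U)
    {x y β₁ : ℝ} (hy : 0 ≤ y) (hmem : ∀ t ∈ Icc (0:ℝ) y, (x : ℂ) + (t : ℂ) * Complex.I ∈ U)
    (hdev : ∀ t ∈ Icc (0:ℝ) y, ‖deriv F ((x : ℂ) + (t : ℂ) * Complex.I) - deriv F (x : ℂ)‖ ≤ β₁) :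
    ‖F ((x : ℂ) + (y : ℂ) * Complex.I) - F (x : ℂ) - ((y : ℂ) * Complex.I) • deriv F (x : ℂ)‖ ≤ β₁ * y := by
  -- apply the integration lemma to `H(w) = F(w) − (w − x)•F′(x)`
  set H : ℂ → (Fin 3 → ℂ) := fun w => F w - (w - (x : ℂ)) • deriv F (x : ℂ) with hH
  have hHd : DifferentiableOn ℂ H U :=
    hF.sub ((differentiableOn_id.sub_const (x : ℂ)).smul_const (deriv F (x : ℂ)))
  have hHderiv : ∀ w ∈ U, deriv H w = deriv F w - deriv F (x : ℂ) := by
    intro w hw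
    have h1 : HasDerivAt F (deriv F w) w := (hF.differentiableAt (hU.mem_nhds hw)).hasDerivAt
    have h2 : HasDerivAt (fun w : ℂ => (w - (x : ℂ)) • deriv F (x : ℂ)) ((1 : ℂ) • deriv F (x : ℂ)) w :=
      ((hasDerivAt_id w).sub_const (x : ℂ)).smul_const _
    have h3 := h1.sub h2
    rw [one_smul] at h3
    exact h3.deriv
  have hbound : ∀ t ∈ Icc (0:ℝ) y, ‖deriv H ((x : ℂ) + (t : ℂ) * Complex.I)‖ ≤ (fun _ => β₁) t := by
    intro t ht
    rw [hHderiv _ (hmem t ht)]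
    exact hdev t ht
  have h := norm_vertical_sub_le_integral hU hHd hy hmem continuousOn_const hbound
  rw [intervalIntegral.integral_const, smul_eq_mul, sub_zero] at h
  have e : H ((x : ℂ) + (y : ℂ) * Complex.I) - H (x : ℂ) =
      F ((x : ℂ) + (y : ℂ) * Complex.I) - F (x : ℂ) - ((y : ℂ) * Complex.I) • deriv F (x : ℂ) := by
    simp only [hH, sub_self, zero_smul, sub_zero, add_sub_cancel_left]
    abel
  rw [e] at h
  linarith [h, mul_comm y β₁]

/-- **Real part of the own-filament base with the vertical structure.**  `u` real (the chord), `T` a real unit vector (the tangent at the foot),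
`y` real, `b` complex with `‖bᵢ‖ ≤ β`: `Re Σᵢ (uᵢ + (iy)Tᵢ + bᵢ)² ≥ ‖u‖² − y² − 3β² − 2√3·β·(‖u‖ + |y|)`. [folklore] -/
theorem re_sum_sq_vertical_linear_ge (u T : EuclideanSpace ℝ (Fin 3)) (hT : ‖T‖ = 1) (y : ℝ) (b : Fin 3 → ℂ) {β : ℝ}
    (hb : ∀ i, ‖b i‖ ≤ β) :
    ‖u‖ ^ 2 - y ^ 2 - 3 * β ^ 2 - 2 * √3 * β * (‖u‖ + |y|) ≤
      (∑ i, (((u i : ℝ) : ℂ) + ((y : ℂ) * Complex.I) * ((T i : ℝ) : ℂ) + b i) ^ 2).re := by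
  have hβ : 0 ≤ β := (norm_nonneg _).trans (hb 0)
  -- componentwise real part
  have hterm : ∀ i, ((((u i : ℝ) : ℂ) + ((y : ℂ) * Complex.I) * ((T i : ℝ) : ℂ) + b i) ^ 2).re =
      (u i + (b i).re) ^ 2 - (y * T i + (b i).im) ^ 2 := by
    intro i
    simp only [sq, Complex.mul_re, Complex.add_re, Complex.add_im, Complex.mul_im, Complex.ofReal_re, Complex.ofReal_im,
      Complex.I_re, Complex.I_im]
    ring
  rw [Complex.re_sum]
  simp only [hterm]
  -- expand: Σ (u + br)² − (yT + bi)² = Σu² + 2Σ u br + Σ br² − y²ΣT² − 2yΣ T bi − Σ bi²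
  have hu2 : ∑ i, (u i) ^ 2 = ‖u‖ ^ 2 := by
    rw [EuclideanSpace.norm_eq, Real.sq_sqrt (Finset.sum_nonneg fun i _ => sq_nonneg _)]
    simp [Real.norm_eq_abs, sq_abs]
  have hT2 : ∑ i, (T i) ^ 2 = 1 := by
    have : ∑ i, (T i) ^ 2 = ‖T‖ ^ 2 := by
      rw [EuclideanSpace.norm_eq, Real.sq_sqrt (Finset.sum_nonneg fun i _ => sq_nonneg _)]
      simp [Real.norm_eq_abs, sq_abs]
    rw [this, hT]; norm_num
  have hbr : ∀ i, |(b i).re| ≤ β := fun i => (Complex.abs_re_le_norm _).trans (hb i)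
  have hbi : ∀ i, |(b i).im| ≤ β := fun i => (Complex.abs_im_le_norm _).trans (hb i)
  -- Cauchy–Schwarz pieces: Σ|u_i| ≤ √3‖u‖, Σ|T_i| ≤ √3
  have hsu : ∑ i, |u i| ≤ √3 * ‖u‖ := by
    have h := sum_mul_le_sqrt_mul_sqrt (fun _ => (1:ℝ)) (fun i => |u i|)
    have h1 : ∑ i : Fin 3, (fun _ => (1:ℝ)) i ^ 2 = 3 := by simp
    have h2 : ∑ i : Fin 3, (fun i => |u i|) i ^ 2 = ‖u‖ ^ 2 := by simp only [sq_abs]; exact hu2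
    rw [h1, h2, Real.sqrt_sq (norm_nonneg _)] at h
    simpa using h
  have hsT : ∑ i, |T i| ≤ √3 := by
    have h := sum_mul_le_sqrt_mul_sqrt (fun _ => (1:ℝ)) (fun i => |T i|)
    have h1 : ∑ i : Fin 3, (fun _ => (1:ℝ)) i ^ 2 = 3 := by simp
    have h2 : ∑ i : Fin 3, (fun i => |T i|) i ^ 2 = 1 := by simp only [sq_abs]; exact hT2
    rw [h1, h2, Real.sqrt_one, mul_one] at h
    simpa using h
  -- lower bound each component expansion
  have hexp : ∀ i, (u i) ^ 2 - 2 * β * |u i| - y ^ 2 * (T i) ^ 2 - 2 * |y| * β * |T i| - β ^ 2 ≤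
      (u i + (b i).re) ^ 2 - (y * T i + (b i).im) ^ 2 := by
    intro i
    have h1 := hbr i; have h2 := hbi i
    have e1 : (u i + (b i).re) ^ 2 - (y * T i + (b i).im) ^ 2 =
        (u i) ^ 2 + 2 * (u i * (b i).re) + (b i).re ^ 2 - y ^ 2 * (T i) ^ 2 - 2 * ((y * T i) * (b i).im) - (b i).im ^ 2 := by ring
    rw [e1]
    have h3 : -(β * |u i|) ≤ u i * (b i).re := by
      have := abs_mul (u i) ((b i).re)
      have h4 : |u i * (b i).re| ≤ |u i| * β := by rw [this]; exact mul_le_mul_of_nonneg_left h1 (abs_nonneg _)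
      nlinarith [neg_abs_le (u i * (b i).re), abs_nonneg (u i)]
    have h5 : (y * T i) * (b i).im ≤ |y| * β * |T i| := by
      have h6 : |(y * T i) * (b i).im| ≤ |y| * |T i| * β := by
        rw [abs_mul, abs_mul]; exact mul_le_mul_of_nonneg_left h2 (by positivity)
      nlinarith [le_abs_self ((y * T i) * (b i).im), abs_nonneg y, abs_nonneg (T i)]
    have h7 : (b i).im ^ 2 ≤ β ^ 2 := by
      have := hbi i
      exact sq_le_sq' (by linarith [neg_abs_le (b i).im]) ((le_abs_self _).trans this)
    nlinarith [sq_nonneg ((b i).re)]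
  have hsum := Finset.sum_le_sum fun i (_ : i ∈ Finset.univ) => hexp i
  have hlhs : ∑ i, ((u i) ^ 2 - 2 * β * |u i| - y ^ 2 * (T i) ^ 2 - 2 * |y| * β * |T i| - β ^ 2) =
      ‖u‖ ^ 2 - 2 * β * (∑ i, |u i|) - y ^ 2 * (∑ i, (T i) ^ 2) - 2 * |y| * β * (∑ i, |T i|) - 3 * β ^ 2 := by
    simp only [Finset.sum_sub_distrib, ← Finset.mul_sum, hu2, Finset.sum_const, Finset.card_univ, Fintype.card_fin]
    ring
  rw [hlhs, hT2] at hsum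
  have hy0 : 0 ≤ |y| := abs_nonneg _
  have k1 : β * (∑ i, |u i|) ≤ β * (√3 * ‖u‖) := mul_le_mul_of_nonneg_left hsu hβ
  have k2 : (|y| * β) * (∑ i, |T i|) ≤ (|y| * β) * √3 := mul_le_mul_of_nonneg_left hsT (mul_nonneg hy0 hβ)
  nlinarith [hsum, k1, k2]

end Summit.NavierStokesRegularity.NavierStokesRegularity.Theorems.StadiumVerticalLinear

end
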